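import Summits.AtomisticToContinuum.Crystallization.Theorems.ChessboardParticlePlanesLjPlaneChessboardSumToMinLayers

/-!
# Crux `ChessboardParticlePlanes.LjPlaneChessboard` (stmt-AtomisticToContinuum-6709), line `Sketch`,
# stub `deficitSite_latticeInvariant` — the per-site chessboard deficit is lattice-invariant

Let `Q` be a periodic configuration of `ℝ³` with next / previous occupied height maps `τu`, `τd`
(hypothesis `Hτ`), a period `w ∈ Q.lattice` of height `w 2 = c₀ > 0`, and all periods of height in
`c₀ℤ`.  Write `S_Q(x)`, `S_up(x)`, `S_dn(x)` for the Lennard-Jones site sums of `x` over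
`Q.points`, over the upward restack of the layers `{x₂ = x 2}, {x₂ = τu (x 2)}` and over the
downward restack of the layers `{x₂ = τd (x 2)}, {x₂ = x 2}` (literal set-builder `tsum`s, as in
the registered crux obligation).

CLAIM (the registered sub-goal).  The per-site chessboard deficit
`d(x) = 2 S_Q(x) - S_up(x) - S_dn(x)` is invariant under the period lattice:
`d(x + g) = d(x)` for `x ∈ Q.points`, `g ∈ Q.lattice`.

PROOF ([folklore], bookkeeping only).  Each of the three site sums is separately invariant.
`S_Q`: `Q.points` is `g`-invariant (`add_mem_points`), so the covariance of site sums
`sumToMin_tsum_shift` applies.  `S_up`, `S_dn`: write `g 2 = c₀ k` (`k ∈ ℤ`) and split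
`g = h + k w` with the HORIZONTAL period `h = g - k w ∈ Q.lattice`, `h 2 = 0`; then
`x + g = (x + h) + k w` and `(x + g) 2 = x 2 + c₀ k`.  The vertical part `k w` is absorbed by
`sumToMin_siteSum_up_shift` / `sumToMin_siteSum_dn_shift` (the restack of the layers at heights
`x 2 + c₀ k`, `τ (x 2 + c₀ k) = τ (x 2) + c₀ k` is the `k w`-translate of the restack at heights
`x 2`, `τ (x 2)`), and the horizontal part `h` by `sumToMin_tsum_shift` again, a restack of two
layers being invariant under every horizontal period (`deficitInv_mem_restack_hshift`).

No definition and no notation is introduced.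
-/

noncomputable section

namespace Summit.AtomisticToContinuum.Crystallization.Theorems.ChessboardParticlePlanesLjPlaneChessboard

open Literature.MathematicalPhysics.StatisticalMechanics

section Horizontal

variable {Q : PeriodicConfiguration 3}

/-- The point set is invariant under a period `g`: `q ∈ Q.points ↔ q - g ∈ Q.points`.
[folklore] -/
theorem deficitInv_mem_points_shift {g : EuclideanSpace ℝ (Fin 3)} (hg : g ∈ Q.lattice)
    (q : EuclideanSpace ℝ (Fin 3)) : q ∈ Q.points ↔ q - g ∈ Q.points := by
  constructor
  · intro hq
    rw [sub_eq_add_neg]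
    exact Q.add_mem_points hq (Q.lattice.neg_mem hg)
  · intro hq
    have := Q.add_mem_points hq hg
    rwa [sub_add_cancel] at this

/-- A restack `R(t,t')` of two layers is invariant under a HORIZONTAL period `h` (`h 2 = 0`):
`q ∈ R(t,t') ↔ q - h ∈ R(t,t')`. [folklore] -/
theorem deficitInv_mem_restack_hshift {h : EuclideanSpace ℝ (Fin 3)} (hh : h ∈ Q.lattice)
    (hh2 : h 2 = 0) (t t' : ℝ) (q : EuclideanSpace ℝ (Fin 3)) :
    q ∈ {p : EuclideanSpace ℝ (Fin 3) | ∃ n : ℤ, ∃ x ∈ Q.points, (x 2 = t ∨ x 2 = t') ∧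
        p = x + ((2 * (t' - t)) * (n : ℝ)) • EuclideanSpace.single (2 : Fin 3) (1 : ℝ)} ↔
    q - h ∈ {p : EuclideanSpace ℝ (Fin 3) | ∃ n : ℤ, ∃ x ∈ Q.points, (x 2 = t ∨ x 2 = t') ∧
        p = x + ((2 * (t' - t)) * (n : ℝ)) • EuclideanSpace.single (2 : Fin 3) (1 : ℝ)} := by
  simp only [Set.mem_setOf_eq]
  constructor
  · rintro ⟨j, x, hx, hxt, rfl⟩
    refine ⟨j, x - h, (deficitInv_mem_points_shift hh x).1 hx, ?_, ?_⟩
    · have e : (x - h) 2 = x 2 := by rw [PiLp.sub_apply, hh2, sub_zero]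
      rw [e]
      exact hxt
    · abel
  · rintro ⟨j, x, hx, hxt, hq⟩
    refine ⟨j, x + h, Q.add_mem_points hx hh, ?_, ?_⟩
    · have e : (x + h) 2 = x 2 := by rw [PiLp.add_apply, hh2, add_zero]
      rw [e]
      exact hxt
    · rw [sub_eq_iff_eq_add] at hq
      rw [hq]
      abel

end Horizontal

/-- **Registered sub-goal `deficitSite_latticeInvariant`: the per-site chessboard deficit is
invariant under the period lattice.**  For a periodic configuration `Q` of `ℝ³` with next /
previous occupied height maps `τu`, `τd`, a period `w` of height `w 2 = c₀ > 0` and all periods of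
height in `c₀ℤ`, the deficit `d(x) = 2 S_Q(x) - S_up(x) - S_dn(x)` of the Lennard-Jones site sums
over `Q.points` and over the upward / downward two-layer restacks through `x` satisfies
`d(x + g) = d(x)` for `x ∈ Q.points`, `g ∈ Q.lattice`. [folklore] -/
theorem deficitSite_latticeInvariant :
    ∀ (Q : PeriodicConfiguration 3) (τu τd : ℝ → ℝ) (w : EuclideanSpace ℝ (Fin 3)) (c₀ : ℝ),
      (∀ t : ℝ, (∃ x ∈ Q.points, x 2 = t) →
        (t < τu t ∧ (∃ x ∈ Q.points, x 2 = τu t) ∧ (∀ x ∈ Q.points, x 2 ≤ t ∨ τu t ≤ x 2)) ∧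
        (τd t < t ∧ (∃ x ∈ Q.points, x 2 = τd t) ∧ (∀ x ∈ Q.points, x 2 ≤ τd t ∨ t ≤ x 2))) →
      0 < c₀ → w ∈ Q.lattice → w 2 = c₀ → (∀ g ∈ Q.lattice, ∃ k : ℤ, g 2 = c₀ * k) →
      ∀ x ∈ Q.points, ∀ g ∈ Q.lattice,
        2 * (∑' y : {y : EuclideanSpace ℝ (Fin 3) // y ∈ Q.points ∧ y ≠ (x + g)}, lennardJones (dist (x + g) y.1))
        - (∑' y : {y : EuclideanSpace ℝ (Fin 3) //
              y ∈ {p : EuclideanSpace ℝ (Fin 3) | ∃ k : ℤ, ∃ x' ∈ Q.points,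
                (x' 2 = (x + g) 2 ∨ x' 2 = τu ((x + g) 2)) ∧
                p = x' + ((2 * (τu ((x + g) 2) - (x + g) 2)) * (k : ℝ)) •
                  EuclideanSpace.single (2 : Fin 3) (1 : ℝ)} ∧ y ≠ (x + g)},
              lennardJones (dist (x + g) y.1))
        - (∑' y : {y : EuclideanSpace ℝ (Fin 3) //
              y ∈ {p : EuclideanSpace ℝ (Fin 3) | ∃ k : ℤ, ∃ x' ∈ Q.points,
                (x' 2 = τd ((x + g) 2) ∨ x' 2 = (x + g) 2) ∧
                p = x' + ((2 * ((x + g) 2 - τd ((x + g) 2))) * (k : ℝ)) •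
                  EuclideanSpace.single (2 : Fin 3) (1 : ℝ)} ∧ y ≠ (x + g)},
              lennardJones (dist (x + g) y.1))
        = 2 * (∑' y : {y : EuclideanSpace ℝ (Fin 3) // y ∈ Q.points ∧ y ≠ x}, lennardJones (dist x y.1))
        - (∑' y : {y : EuclideanSpace ℝ (Fin 3) //
              y ∈ {p : EuclideanSpace ℝ (Fin 3) | ∃ k : ℤ, ∃ x' ∈ Q.points,
                (x' 2 = x 2 ∨ x' 2 = τu (x 2)) ∧
                p = x' + ((2 * (τu (x 2) - x 2)) * (k : ℝ)) •
                  EuclideanSpace.single (2 : Fin 3) (1 : ℝ)} ∧ y ≠ x},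
              lennardJones (dist x y.1))
        - (∑' y : {y : EuclideanSpace ℝ (Fin 3) //
              y ∈ {p : EuclideanSpace ℝ (Fin 3) | ∃ k : ℤ, ∃ x' ∈ Q.points,
                (x' 2 = τd (x 2) ∨ x' 2 = x 2) ∧
                p = x' + ((2 * (x 2 - τd (x 2))) * (k : ℝ)) •
                  EuclideanSpace.single (2 : Fin 3) (1 : ℝ)} ∧ y ≠ x},
              lennardJones (dist x y.1)) := by
  intro Q τu τd w c₀ Hτ _ hw hw2 hper x hx g hg
  obtain ⟨k, hk⟩ := hper g hg
  -- the horizontal part `g - k w` of the period `g`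
  have hh : g - (k : ℝ) • w ∈ Q.lattice := Q.lattice.sub_mem hg (sumToMin_zsmul_mem hw k)
  have hh2 : (g - (k : ℝ) • w) 2 = 0 := by
    rw [PiLp.sub_apply, PiLp.smul_apply, hk, hw2, smul_eq_mul]
    ring
  have hxg : x + g = x + (g - (k : ℝ) • w) + (k : ℝ) • w := by rw [add_assoc, sub_add_cancel]
  have hxg2 : (x + g) 2 = x 2 + c₀ * k := by rw [PiLp.add_apply, hk]
  have hs : ∃ y ∈ Q.points, y 2 = x 2 := ⟨x, hx, rfl⟩
  -- `S_Q` is invariant under the whole period `g`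
  rw [sumToMin_tsum_shift lennardJones g x (deficitInv_mem_points_shift hg)]
  -- `S_up`, `S_dn`: first the vertical part `k w`, then the horizontal part `g - k w`
  rw [hxg2, hxg, sumToMin_siteSum_up_shift Hτ hw hw2 lennardJones hs k (x + (g - (k : ℝ) • w)),
    sumToMin_siteSum_dn_shift Hτ hw hw2 lennardJones hs k (x + (g - (k : ℝ) • w)),
    sumToMin_tsum_shift lennardJones (g - (k : ℝ) • w) x
      (deficitInv_mem_restack_hshift hh hh2 (x 2) (τu (x 2))),
    sumToMin_tsum_shift lennardJones (g - (k : ℝ) • w) x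
      (deficitInv_mem_restack_hshift hh hh2 (τd (x 2)) (x 2))]

end Summit.AtomisticToContinuum.Crystallization.Theorems.ChessboardParticlePlanesLjPlaneChessboard

end
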